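import Summits.CriticalPhenomena.PercolationContinuityZ3.Theorems.PercNearOneGluingNoHeavyLowerTailAntitheticApexCone
import HarnessLib

/-!
# `NoHeavyLowerTail` (stmt-CriticalPhenomena-4575) — antithetic cluster pairs: THEOREM K⁺ — BIC for every avoidance set on CONES WITH
# CONNECTED-NEIGHBOURHOOD APEXES (prim-hp-2 gen 37; MEMO-gen37 §3)

Support file (`--supports stmt-CriticalPhenomena-4575`, hull-port prover `prim-hp-2`, gen 37).  No definitions, no named facts, no sorries;
standard axioms.

THEOREM K (`Antithetic.apexCone_bic_nonneg`, …AntitheticApexCone) asks that every vertex `x ≠ s` not adjacent to `s` have a neighbourhood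
which is a CLIQUE of neighbours of `s`.  The zone-system proof uses this only through the KEY PROPERTY (every vertex reached in neither
colour has a monochromatic star, `Antithetic.keyCone_bic_nonneg`), and the key property already follows when the neighbourhood `N(x) ⊆ N(s)`
induces a CONNECTED graph: if an unreached `x` had red edges to `A ⊆ N(x)` and blue edges to `N(x) ∖ A`, both non-empty, connectivity gives
adjacent `u ∈ A`, `v ∈ N(x) ∖ A`; then `u` is blue-reached only, `v` red-reached only (their spokes exist), and the edge `uv` can be neither red
nor blue (`ACone.mono_of_unreached_conn`).  Connectivity of `G[N(x)]` is stated cut-free: every split of `N(x)` into two non-empty parts has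
an edge of `E` across it (`hconn`).
* `Antithetic.nbhdConnCone_bic_nonneg` — THEOREM K⁺: `BIC_E(R) ≥ 0` for every `R` on this class (e.g. `E = {01,02,03,12,13,14,24,34}`, `s = 0`:
  `N(4) = {1,2,3}` is connected through `1` but not a clique — one of the four `(G,s)`-classes on 5 vertices beyond THEOREM K on which the
  gen-37 rule census (lab37/v5_classes.py) reports 0 failures for all `R`).
(The class is not closed under deleting the edges at a vertex, so the sink version `T_E(R,X) ≥ 0` is claimed only for the clique class,
`Antithetic.apexCone_tsum_nonneg`.)
[cite: VandenbergHaggstromKahn2005, §1 p. 3 (open cluster `C_s`)]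
-/

noncomputable section

namespace Summit.CriticalPhenomena.PercolationContinuityZ3.Theorems

open Literature.Probability.Percolation
open scoped Classical symmDiff

namespace Antithetic

namespace ACone

variable {V : Type*} {E : Set (Sym2 V)} {s : V} {T : Set (Sym2 V)} {x : V}

/-- **Key fact for connected neighbourhoods.**  If every `E`-neighbour of the spoke-less vertex `x ≠ s` is adjacent to `s` and `N(x)` has
no edgeless cut, then `x`, when reached in neither colour, has a monochromatic star. [this work] -/
theorem mono_of_unreached_conn (hN : ∀ x u, x ≠ s → s(s, x) ∉ E → s(x, u) ∈ E → u ≠ x → s(s, u) ∈ E)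
    (hconn : ∀ x, x ≠ s → s(s, x) ∉ E → ∀ A : Set V,
      (∃ u, s(x, u) ∈ E ∧ u ≠ x ∧ u ∈ A) → (∃ v, s(x, v) ∈ E ∧ v ≠ x ∧ v ∉ A) →
      ∃ u v, s(x, u) ∈ E ∧ u ≠ x ∧ u ∈ A ∧ s(x, v) ∈ E ∧ v ≠ x ∧ v ∉ A ∧ s(u, v) ∈ E)
    (hr : ¬ (openGraph (T ∩ E)).Reachable s x) (hb : ¬ (openGraph (Tᶜ ∩ E)).Reachable s x) :
    (∀ u, s(x, u) ∈ E → u ≠ x → s(x, u) ∈ T) ∨ (∀ u, s(x, u) ∈ E → u ≠ x → s(x, u) ∉ T) := by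
  have hxs : x ≠ s := ne_source_of_unreached hr
  have hsx : s(s, x) ∉ E := spokeless_of_unreached hr hb
  by_contra hcon
  rw [not_or] at hcon
  obtain ⟨h1, h2⟩ := hcon
  push Not at h1 h2
  obtain ⟨v₀, hv₀E, hv₀x, hv₀T⟩ := h1
  obtain ⟨u₀, hu₀E, hu₀x, hu₀T⟩ := h2
  -- the red neighbours form a non-trivial cut of `N(x)`
  obtain ⟨u, v, huE, hux, huT, hvE, hvx, hvT, huv⟩ := hconn x hxs hsx {u | s(x, u) ∈ T} ⟨u₀, hu₀E, hu₀x, hu₀T⟩ ⟨v₀, hv₀E, hv₀x, hv₀T⟩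
  have huT : s(x, u) ∈ T := huT
  have hvT : s(x, v) ∉ T := hvT
  have hune : u ≠ v := by
    rintro rfl
    exact hvT huT
  -- `u` is not red-reached (else `x` would be), so its spoke is blue and `u` is blue-reached; `v` symmetric
  have hu_nr : ¬ (openGraph (T ∩ E)).Reachable s u := fun h =>
    hr (h.trans ((openGraph_adj (T ∩ E) u x).2 ⟨⟨by rw [Sym2.eq_swap]; exact huT, by rw [Sym2.eq_swap]; exact huE⟩, hux⟩).reachable)
  have hv_nb : ¬ (openGraph (Tᶜ ∩ E)).Reachable s v := fun h =>
    hb (h.trans ((openGraph_adj (Tᶜ ∩ E) v x).2 ⟨⟨by rw [Sym2.eq_swap]; exact hvT, by rw [Sym2.eq_swap]; exact hvE⟩, hvx⟩).reachable)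
  have hus : u ≠ s := by
    rintro rfl
    exact hu_nr (SimpleGraph.Reachable.refl _)
  have hvs : v ≠ s := by
    rintro rfl
    exact hv_nb (SimpleGraph.Reachable.refl _)
  have hsu : s(s, u) ∈ E := hN x u hxs hsx huE hux
  have hsv : s(s, v) ∈ E := hN x v hxs hsx hvE hvx
  have hu_b : (openGraph (Tᶜ ∩ E)).Reachable s u := (reached_of_spoke E T hsu hus).resolve_left hu_nr
  have hv_r : (openGraph (T ∩ E)).Reachable s v := (reached_of_spoke E T hsv hvs).resolve_right hv_nb
  by_cases huvT : s(u, v) ∈ T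
  · exact hu_nr (hv_r.trans ((openGraph_adj (T ∩ E) v u).2
      ⟨⟨by rw [Sym2.eq_swap]; exact huvT, by rw [Sym2.eq_swap]; exact huv⟩, hune.symm⟩).reachable)
  · exact hv_nb (hu_b.trans ((openGraph_adj (Tᶜ ∩ E) u v).2 ⟨⟨huvT, huv⟩, hune⟩).reachable)

end ACone

section TheoremKPlus

variable {V : Type*} [Fintype V]

/-- **THEOREM K⁺ (prim-hp-2 gen 37): BIC on cones with connected-neighbourhood apexes, every avoidance set.**  `E` an edge set on a finite
vertex type, `s` a source such that every vertex `x ≠ s` with `sx ∉ E` has all its `E`-neighbours adjacent to `s` (`hN`) and a neighbourhood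
without edgeless cuts (`hconn`: for every `A`, if `x` has a neighbour in `A` and one outside, then some neighbour in `A` and some neighbour
outside `A` are adjacent).  Then for every vertex set `R` and all increasing `F, G` of the edge cluster,
`0 ≤ Σ_{ω : no r ∈ R is joined to s both in ω ∩ E and in ωᶜ ∩ E} (F(C_s(ω∩E)) − F(C_s(ωᶜ∩E))) · (G(C_s(ω∩E)) − G(C_s(ωᶜ∩E)))`. [this work] -/
theorem nbhdConnCone_bic_nonneg (E : Set (Sym2 V)) (s : V)
    (hN : ∀ x u, x ≠ s → s(s, x) ∉ E → s(x, u) ∈ E → u ≠ x → s(s, u) ∈ E)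
    (hconn : ∀ x, x ≠ s → s(s, x) ∉ E → ∀ A : Set V,
      (∃ u, s(x, u) ∈ E ∧ u ≠ x ∧ u ∈ A) → (∃ v, s(x, v) ∈ E ∧ v ≠ x ∧ v ∉ A) →
      ∃ u v, s(x, u) ∈ E ∧ u ≠ x ∧ u ∈ A ∧ s(x, v) ∈ E ∧ v ≠ x ∧ v ∉ A ∧ s(u, v) ∈ E)
    (R : Set V) {F G : Set (Sym2 V) → ℝ} (hF : Monotone F) (hG : Monotone G) :
    0 ≤ ∑ ω ∈ Finset.univ.filter (fun ω : Set (Sym2 V) =>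
        ∀ r ∈ R, ¬ ((openGraph (ω ∩ E)).Reachable s r ∧ (openGraph (ωᶜ ∩ E)).Reachable s r)),
      (F (openEdgeCluster (ω ∩ E) s) - F (openEdgeCluster (ωᶜ ∩ E) s)) *
        (G (openEdgeCluster (ω ∩ E) s) - G (openEdgeCluster (ωᶜ ∩ E) s)) :=
  keyCone_bic_nonneg E s (fun _ _ hr hb => ACone.mono_of_unreached_conn hN hconn hr hb) R hF hG

end TheoremKPlus

end Antithetic

end Summit.CriticalPhenomena.PercolationContinuityZ3.Theorems
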